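import Literature.NumberTheory.Irrationality.KrattenthalerRivoal2007.PropositionSixTop
import Literature.NumberTheory.Irrationality.KrattenthalerRivoal2007.PropositionSixInnerOdd
import HarnessLib

/-!
# Proposition 6 for odd `A`: the top level and the assembly

[KrattenthalerRivoal2007, §12, Proposition 6] for ODD `A = 2M+3` ("les arguments sont complètement analogues"): with
the odd inner chain of `PropositionSixInnerOdd.lean` (`innerOFlat`, dictionary `rawInnerO_dictionary`) and the SAME top
line as in the even case (`PropositionSixTop.lean`: `topRaw`, `top_brick_identity`, `topRaw_zero_r_top` — the prefix
`C(n,k)(ε−n)_k(rn+ε+1)_k` and the balanced `₄F₃` of `sPolFour` are those of `sPolThree`), we define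
`gKROdd = K·S(ε)/ε` in the tree's normalisation for odd `A` and prove (eq:briques) in full:

* `r ≥ 1`, `B ≥ 2`: `gKROdd = ± Σ_k Σ_u brickTermOdd(k,u)`, `brickTermOdd = (−1)^{k+v} · R(0,n+1;−ε)(−ε) ·
  ∏_{q=1}^{r−1} R(n,0;qn+1−ε) · innerOFlat(k) · R₂ · ∏_q R(n,0;qn+ε+1) · R₁ · R(n−i,0;rn+i+ε+2)` — relative to the even
  case the extra integral factor `∏_{q=1}^{r−1} R(n,0;qn+1−ε) = (1−ε)_{rn}/((1−ε)_n n!^{r−1})` (`pbBlockMinus n (r−1) (n+1)`)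
  appears (the normaliser bookkeeping of the confluent level);
* `r ≥ 1`, `B = 1`: `(R(0,n+1;−ε)(−ε))²` and no block bricks (`brickTermOddOne`);
* `r = 0`: the degenerate top line (`topRaw_zero_r_top`): `gKROdd n M B' 0 = ± Σ_k (−1)^k C(n+1,k+1)(R(0,n+1;−ε)(−ε))²·innerOFlat(k)`,
and hence **`proposition6_odd'`**: `IsDInt (d_n) N (gKROdd n M B' r) 0` for every `M`, `B'`, `r`, `N` — Krattenthaler–Rivoal's
Proposition 6 for every odd `A ≥ 3`, every `B ≥ 1`, every `r ≥ 0`. (Even `A`: `proposition6_even'`.) The scalar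
identities were found and checked in an exact-rational model (custody `tools/check_odd_chain.py`).

## References
* [KrattenthalerRivoal2007] §12 Proposition 6 and its proof, (eq:briques); §10 Corollaires 4, 6; §11 Lemmes 9–10
  (arXiv:math/0311114 pp. 22–25, 29).
-/

open Finset Filter
open scoped Nat
open Literature.NumberTheory.Transcendental
open Literature.Combinatorics.Enumerative.BaileyChain
open Literature.Combinatorics.Enumerative (balFourFThree)

namespace Literature.NumberTheory.Irrationality.KrattenthalerRivoal2007

/-! ### Rising factorials (private shorthand) -/

/-- `(z)_m` (private shorthand). [folklore] -/
private def pw (z : ℚ) (m : ℕ) : ℚ := ∏ i ∈ range m, (z + i)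

/-- Unfolding. [folklore] -/
private theorem pw_def (z : ℚ) (m : ℕ) : pw z m = ∏ i ∈ range m, (z + i) := rfl

/-- `(z)_{m₁+m₂} = (z)_{m₁}(z+m₁)_{m₂}`. [folklore] -/
private theorem pw_add (z : ℚ) (m₁ m₂ : ℕ) : pw z (m₁ + m₂) = pw z m₁ * pw (z + m₁) m₂ := by
  simp only [pw, prod_range_add]
  congr 1
  refine prod_congr rfl fun i _ => ?_
  push_cast
  ring

/-- Congruence. [folklore] -/
private theorem pw_congr {z z' : ℚ} (h : z = z') (m : ℕ) : pw z m = pw z' m := by rw [h]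

/-- Blocks of length `n`. [folklore] -/
private theorem pw_mul_blocks (z : ℚ) (r n : ℕ) : pw z (r * n) = ∏ q ∈ range r, pw (z + q * n) n := by
  induction r with
  | zero => simp [pw]
  | succ r ih =>
    rw [Nat.succ_mul, pw_add, ih, prod_range_succ]
    congr 1
    exact pw_congr (by push_cast; ring) n

/-- `(1−ε)_n · (∏_{q<r'} R(n,0;qn+n+1−ε) · n!^{r'}) = (1−ε)_{(r'+1)n}`: the block bricks above the first block.
[cite: KrattenthalerRivoal2007, §12 (eq:briques) (the products ∏_q R(n,0;nq−ε+1))] -/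
theorem prod_mul_pbBlockMinus_succ (n r' : ℕ) (ε : ℚ) :
    (∏ l ∈ range n, (1 - ε + (l : ℚ))) * (pbBlockMinus n r' (n + 1) ε * (n ! : ℚ) ^ r') =
      ∏ l ∈ range ((r' + 1) * n), (1 - ε + (l : ℚ)) := by
  have hb : pbBlockMinus n r' (n + 1) ε * (n ! : ℚ) ^ r' = pw (((n + 1 : ℕ) : ℚ) - ε) (r' * n) := by
    unfold pbBlockMinus polyBrick
    rw [prod_div_distrib, prod_const, card_range, div_mul_cancel₀ _ (by positivity), pw_mul_blocks]
    refine prod_congr rfl fun q _ => ?_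
    rw [← pw_def]
    exact pw_congr (by push_cast; ring) _
  rw [hb, ← pw_def, ← pw_def, show (r' + 1) * n = n + r' * n by ring, pw_add]
  congr 1
  exact pw_congr (by push_cast; ring) _

/-! ### `gKROdd` and the top form of `sPolFour` -/

/-- `gKROdd = K·S(ε)/ε` in the tree's normalisation for odd `A = 2M+3`, `B = B'+1`:
`((−1)^{rn})^B (−1)^{nB'} · n!^{A−1} ((1−ε)_{rn}(1+ε)_{rn})^B / (((1−ε)_n(1+ε)_n)^{A+B} n!^{2Br}) · sPolFour`.
[cite: KrattenthalerRivoal2007, §12 proof of Proposition 6 («S(ε) = ε·(…)», odd A); §10 Corollaire 4] -/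
def gKROdd (n M B' r : ℕ) (ε : ℚ) : ℚ :=
  ((-1 : ℚ) ^ (r * n)) ^ (B' + 1) * (-1) ^ (n * B') *
    ((n ! : ℚ) ^ (2 * M + 2) *
      ((∏ l ∈ range (r * n), (1 - ε + (l : ℚ))) * ∏ l ∈ range (r * n), (1 + ε + (l : ℚ))) ^ (B' + 1) /
      ((((∏ l ∈ range n, (1 - ε + (l : ℚ))) * ∏ l ∈ range n, (1 + ε + (l : ℚ))) ^ (2 * M + 3 + (B' + 1))) *
        (n ! : ℚ) ^ (2 * (B' + 1) * r))) *
    sPolFour ε n M B' r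

/-- **`sPolFour` with the top `₄F₃` in KR's form** (same top as `sPolThree_eq_KR`).
[cite: KrattenthalerRivoal2007, §12 proof of Prop. 6, odd A; §6 Théorème 9] -/
theorem sPolFour_eq_KR (ε : ℚ) (n M B' r : ℕ) :
    sPolFour ε n M B' r = ∑ k ∈ range (n + 1), (n.choose k : ℚ) * (∏ j ∈ range k, (ε - n + j)) *
      (∏ j ∈ range k, (((r * n : ℕ) : ℚ) + ε + 1 + j)) * rawInnerO n r M B' k ε * balFourFThreeKR ε n r k := by
  rw [sPolFour_eq_sum_rawInnerO]
  refine sum_congr rfl fun k hk => ?_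
  rw [balFourFThree_top_eq_KR ε n r k (Nat.lt_succ_iff.mp (mem_range.mp hk))]

/-! ### Assembly for `r ≥ 1`, `B ≥ 2` -/

/-- The `(k,u)` summand of (eq:briques), odd `A`, `B ≥ 2` (`i = k+u`, `v = n−k−u`):
`(−1)^{k+v} · R(0,n+1;−ε)(−ε) · ∏_{q=1}^{r−1}R(n,0;qn+1−ε) · innerOFlat(k) · R₂(n,k,i;ε) · ∏_{q<r}R(n,0;qn+ε+1) · R₁(n,i,i;ε) ·
R(v,0;rn+i+2+ε)`. [cite: KrattenthalerRivoal2007, §12 proof of Proposition 6, (eq:briques), odd A] -/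
def brickTermOdd (n r M B' k u : ℕ) (ε : ℚ) : ℚ :=
  (-1) ^ (k + (n - k - u)) * (rbMinus n ε * pbBlockMinus n (r - 1) (n + 1) ε) * innerOFlat n r M B' k ε *
    (specialBrickR2 n r k (k + u) ε * pbBlockPlus n r 1 ε * specialBrickR1 n r (k + u) (k + u) ε *
      polyBrick (((r * n + (k + u) + 2 : ℕ) : ℤ)) (n - k - u) ε)

/-- Every `brickTermOdd` is `d_n`-integral to all orders at `ε = 0` (Lemmes 9, 10 and `innerOFlat_isDInt`).
[cite: KrattenthalerRivoal2007, §12 proof of Proposition 6 ((eq:briques) ⇒ (eq:6)), odd A; §11 Lemmes 9–10] -/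
theorem brickTermOdd_isDInt {n r : ℕ} (hr : 1 ≤ r) (M B' : ℕ) {k u : ℕ} (hku : k + u ≤ n) (N : ℕ) :
    IsDInt (Nat.lcmUpto n) N (brickTermOdd n r M B' k u) 0 := by
  have h1 := IsDInt.const (Nat.lcmUpto n) N ((-1) ^ (k + (n - k - u))) 0
  have h2 := (rbMinus_isDInt (n := n) (i := n) le_rfl N).mul (pbBlockMinus_isDInt (n := n) (r := r - 1) (n + 1) N)
  have h3 := innerOFlat_isDInt (n := n) (r := r) N M B' k (by omega)
  have h4 := specialBrickR2_isDInt n r k (k + u) hr (by omega) hku N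
  have h5 := pbBlockPlus_isDInt (n := n) (r := r) 1 N
  have h6 := specialBrickR1_isDInt n r (k + u) (k + u) hr hku N
  have h7 := polyBrick_eps_isDInt (((r * n + (k + u) + 2 : ℕ) : ℤ)) (show n - k - u ≤ n by omega) N
  exact (((h1.mul h2).mul h3).mul (((h4.mul h5).mul h6).mul h7)).congr
    (Eventually.of_forall fun ε => by simp only [brickTermOdd]; push_cast; ring)

/-- The normalisers collapse (odd `A`, `B ≥ 2`, `r = r'+1`): prefactor · dictionary factor · top-line factor
`= n!/(1−ε)_n · ∏_{q=1}^{r−1} R(n,0;qn+1−ε)`. [cite: KrattenthalerRivoal2007, §12 proof of Proposition 6, (eq:briques), odd A] -/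
private theorem assembly_scalar_odd (n r' M b : ℕ) {Rm Rp Dm Dp P : ℚ} (hRp : Rp ≠ 0) (hDm : Dm ≠ 0)
    (hDp : Dp ≠ 0) (hP : Dm * (P * (n ! : ℚ) ^ r') = Rm) (hRm : Rm ≠ 0) :
    (n ! : ℚ) ^ (2 * M + 2) * (Rm * Rp) ^ (b + 1 + 1) /
        ((Dm * Dp) ^ (2 * M + 3 + (b + 1 + 1)) * (n ! : ℚ) ^ (2 * (b + 1 + 1) * (r' + 1))) *
      (Dp ^ 2 * ((Dm * Dp) ^ 2) ^ M *
          ((Dm * Dp) ^ 2 * ((n ! : ℚ) ^ (2 * (r' + 1)) * Dm * Dp) ^ b) /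
        (((n ! : ℚ) ^ 2) ^ M * ((n ! : ℚ) * (Rm * Rp) ^ b))) *
      ((n ! : ℚ) ^ (3 * (r' + 1)) * (n ! : ℚ) * Dm * Dp / (Rm * Rp ^ 2)) = (n ! : ℚ) / Dm * P := by
  subst hP
  have hn : (n ! : ℚ) ≠ 0 := by positivity
  have hPn : P ≠ 0 := by
    rintro rfl
    exact hRm (by ring)
  field_simp
  ring

/-- **The key pointwise identity, odd `A`, `B ≥ 2`, `r ≥ 1`**: off the zeros of `(1∓ε)_n (1∓ε)_{rn}`,
`gKROdd(ε) = ((−1)^{rn})^B (−1)^{nB'} · Σ_{k≤n} Σ_{u≤n−k} brickTermOdd(k,u)(ε)` (`B' = b+1`, `r = r'+1`).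
[cite: KrattenthalerRivoal2007, §12 proof of Proposition 6, (eq:briques), odd A] -/
theorem gKROdd_eq_sum_brickTermOdd (n M b r' : ℕ) {ε : ℚ}
    (hDm : ∏ l ∈ range n, (1 - ε + (l : ℚ)) ≠ 0) (hDp : ∏ l ∈ range n, (1 + ε + (l : ℚ)) ≠ 0)
    (hRm : ∏ l ∈ range ((r' + 1) * n), (1 - ε + (l : ℚ)) ≠ 0)
    (hRp : ∏ l ∈ range ((r' + 1) * n), (1 + ε + (l : ℚ)) ≠ 0) :
    gKROdd n M (b + 1) (r' + 1) ε = ((-1 : ℚ) ^ ((r' + 1) * n)) ^ (b + 1 + 1) * (-1) ^ (n * (b + 1)) *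
      ∑ k ∈ range (n + 1), ∑ u ∈ range (n - k + 1), brickTermOdd n (r' + 1) M (b + 1) k u ε := by
  unfold gKROdd
  rw [sPolFour_eq_KR, mul_sum, mul_sum]
  refine sum_congr rfl fun k hk => ?_
  have hkn : k ≤ n := Nat.lt_succ_iff.mp (mem_range.mp hk)
  set Rm := ∏ l ∈ range ((r' + 1) * n), (1 - ε + (l : ℚ)) with hRmdef
  set Rp := ∏ l ∈ range ((r' + 1) * n), (1 + ε + (l : ℚ)) with hRpdef
  set Dm := ∏ l ∈ range n, (1 - ε + (l : ℚ)) with hDmdef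
  set Dp := ∏ l ∈ range n, (1 + ε + (l : ℚ)) with hDpdef
  have hn : (n ! : ℚ) ≠ 0 := by positivity
  have hEXv : normEXO n (r' + 1) ε (b + 1) = (n ! : ℚ) * (Rm * Rp) ^ b := by
    simp only [normEXO]; rw [← hRmdef, ← hRpdef]
  have hDXv : normDXO n (r' + 1) ε (b + 1) = (Dm * Dp) ^ 2 * ((n ! : ℚ) ^ (2 * (r' + 1)) * Dm * Dp) ^ b := by
    simp only [normDXO]; rw [← hDmdef, ← hDpdef]
  have hEX : ((n ! : ℚ) ^ 2) ^ M * ((n ! : ℚ) * (Rm * Rp) ^ b) ≠ 0 := by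
    have : Rm * Rp ≠ 0 := mul_ne_zero hRm hRp
    positivity
  -- the inner dictionary, solved for `rawInnerO`
  have e1 : rawInnerO n (r' + 1) M (b + 1) k ε = Dp ^ 2 * ((Dm * Dp) ^ 2) ^ M *
      ((Dm * Dp) ^ 2 * ((n ! : ℚ) ^ (2 * (r' + 1)) * Dm * Dp) ^ b) *
      ((k ! : ℚ) * innerOFlat n (r' + 1) M (b + 1) k ε) / (((n ! : ℚ) ^ 2) ^ M * ((n ! : ℚ) * (Rm * Rp) ^ b)) := by
    rw [eq_div_iff hEX, ← innerO_eq_flat, ← hEXv, ← hDXv]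
    linear_combination rawInnerO_dictionary n (r' + 1) M (b + 1) k hkn hDp hDm
  -- the top line, solved for `topRaw`
  have e3 : ∀ u ∈ range (n - k + 1), topRaw n (r' + 1) k u ε =
      (-1) ^ (k + (n - k - u)) * ((n ! : ℚ) ^ (3 * (r' + 1)) * (n ! : ℚ) * Dm * Dp) *
        (specialBrickR2 n (r' + 1) k (k + u) ε * pbBlockPlus n (r' + 1) 1 ε *
          specialBrickR1 n (r' + 1) (k + u) (k + u) ε *
          polyBrick ((((r' + 1) * n + (k + u) + 2 : ℕ) : ℤ)) (n - k - u) ε) / (Rm * Rp ^ 2) := fun u hu => by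
    rw [eq_div_iff (mul_ne_zero hRm (pow_ne_zero _ hRp))]
    linear_combination top_brick_identity n (r' + 1) k u (Nat.succ_pos r') (by have := mem_range.mp hu; omega) ε
  -- the extra block brick
  set P := pbBlockMinus n r' (n + 1) ε with hPdef
  have hP : Dm * (P * (n ! : ℚ) ^ r') = Rm := by
    rw [hDmdef, hPdef, hRmdef]; exact prod_mul_pbBlockMinus_succ n r' ε
  have hsc := assembly_scalar_odd n r' M b hRp hDm hDp hP hRm
  calc ((-1 : ℚ) ^ ((r' + 1) * n)) ^ (b + 1 + 1) * (-1) ^ (n * (b + 1)) *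
        ((n ! : ℚ) ^ (2 * M + 2) * (Rm * Rp) ^ (b + 1 + 1) /
          ((Dm * Dp) ^ (2 * M + 3 + (b + 1 + 1)) * (n ! : ℚ) ^ (2 * (b + 1 + 1) * (r' + 1)))) *
        ((n.choose k : ℚ) * (∏ j ∈ range k, (ε - n + j)) * (∏ j ∈ range k, ((((r' + 1) * n : ℕ) : ℚ) + ε + 1 + j)) *
          rawInnerO n (r' + 1) M (b + 1) k ε * balFourFThreeKR ε n (r' + 1) k)
      = ((-1 : ℚ) ^ ((r' + 1) * n)) ^ (b + 1 + 1) * (-1) ^ (n * (b + 1)) *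
        ((n ! : ℚ) ^ (2 * M + 2) * (Rm * Rp) ^ (b + 1 + 1) /
          ((Dm * Dp) ^ (2 * M + 3 + (b + 1 + 1)) * (n ! : ℚ) ^ (2 * (b + 1 + 1) * (r' + 1)))) *
        (Dp ^ 2 * ((Dm * Dp) ^ 2) ^ M *
          ((Dm * Dp) ^ 2 * ((n ! : ℚ) ^ (2 * (r' + 1)) * Dm * Dp) ^ b) /
          (((n ! : ℚ) ^ 2) ^ M * ((n ! : ℚ) * (Rm * Rp) ^ b))) * innerOFlat n (r' + 1) M (b + 1) k ε *
        ∑ u ∈ range (n - k + 1), topRaw n (r' + 1) k u ε := by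
        rw [e1, topRaw_sum]; ring
    _ = ∑ u ∈ range (n - k + 1), ((-1 : ℚ) ^ ((r' + 1) * n)) ^ (b + 1 + 1) * (-1) ^ (n * (b + 1)) *
        ((n ! : ℚ) ^ (2 * M + 2) * (Rm * Rp) ^ (b + 1 + 1) /
          ((Dm * Dp) ^ (2 * M + 3 + (b + 1 + 1)) * (n ! : ℚ) ^ (2 * (b + 1 + 1) * (r' + 1)))) *
        (Dp ^ 2 * ((Dm * Dp) ^ 2) ^ M *
          ((Dm * Dp) ^ 2 * ((n ! : ℚ) ^ (2 * (r' + 1)) * Dm * Dp) ^ b) /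
          (((n ! : ℚ) ^ 2) ^ M * ((n ! : ℚ) * (Rm * Rp) ^ b))) * innerOFlat n (r' + 1) M (b + 1) k ε *
        topRaw n (r' + 1) k u ε := by rw [mul_sum]
    _ = ∑ u ∈ range (n - k + 1), ((-1 : ℚ) ^ ((r' + 1) * n)) ^ (b + 1 + 1) * (-1) ^ (n * (b + 1)) *
        brickTermOdd n (r' + 1) M (b + 1) k u ε := by
        refine sum_congr rfl fun u hu => ?_
        rw [e3 u hu, brickTermOdd, rbMinus, ← hDmdef, Nat.add_sub_cancel, ← hPdef]
        calc _ = ((-1 : ℚ) ^ ((r' + 1) * n)) ^ (b + 1 + 1) * (-1) ^ (n * (b + 1)) * ((-1) ^ (k + (n - k - u)) *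
              innerOFlat n (r' + 1) M (b + 1) k ε *
              (specialBrickR2 n (r' + 1) k (k + u) ε * pbBlockPlus n (r' + 1) 1 ε *
                specialBrickR1 n (r' + 1) (k + u) (k + u) ε *
                polyBrick ((((r' + 1) * n + (k + u) + 2 : ℕ) : ℤ)) (n - k - u) ε)) *
            ((n ! : ℚ) ^ (2 * M + 2) * (Rm * Rp) ^ (b + 1 + 1) /
                ((Dm * Dp) ^ (2 * M + 3 + (b + 1 + 1)) * (n ! : ℚ) ^ (2 * (b + 1 + 1) * (r' + 1))) *
              (Dp ^ 2 * ((Dm * Dp) ^ 2) ^ M *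
                  ((Dm * Dp) ^ 2 * ((n ! : ℚ) ^ (2 * (r' + 1)) * Dm * Dp) ^ b) /
                (((n ! : ℚ) ^ 2) ^ M * ((n ! : ℚ) * (Rm * Rp) ^ b))) *
              ((n ! : ℚ) ^ (3 * (r' + 1)) * (n ! : ℚ) * Dm * Dp / (Rm * Rp ^ 2))) := by ring
          _ = _ := by rw [hsc]; ring
    _ = _ := by rw [← mul_sum]

/-- Near `ε = 0` nothing vanishes. [folklore] -/
private theorem prod_one_add_ne_zero' {ε : ℚ} (h1 : ε < 1 / 2) (h2 : -(1 / 2) < ε) (m : ℕ) :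
    (∏ l ∈ range m, (1 - ε + (l : ℚ))) ≠ 0 ∧ (∏ l ∈ range m, (1 + ε + (l : ℚ))) ≠ 0 := by
  refine ⟨prod_ne_zero_iff.2 fun l _ => ?_, prod_ne_zero_iff.2 fun l _ => ?_⟩
  · have : (0 : ℚ) ≤ l := Nat.cast_nonneg l
    exact ne_of_gt (by linarith)
  · have : (0 : ℚ) ≤ l := Nat.cast_nonneg l
    exact ne_of_gt (by linarith)

/-- **Krattenthaler–Rivoal's Proposition 6, case `A = 2M+3` odd, `B = b+2 ≥ 2`, `r = r'+1 ≥ 1`**: for every `N`,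
`IsDInt (d_n) N (gKROdd n M (b+1) (r'+1)) 0`. [cite: KrattenthalerRivoal2007, §12 Proposition 6 (i), case A odd, B ≥ 2, r ≥ 1] -/
theorem proposition6_oddA (n M b r' : ℕ) (N : ℕ) : IsDInt (Nat.lcmUpto n) N (gKROdd n M (b + 1) (r' + 1)) 0 := by
  have hS : IsDInt (Nat.lcmUpto n) N (fun ε => ((-1 : ℚ) ^ ((r' + 1) * n)) ^ (b + 1 + 1) * (-1) ^ (n * (b + 1)) *
      ∑ k ∈ range (n + 1), ∑ u ∈ range (n - k + 1), brickTermOdd n (r' + 1) M (b + 1) k u ε) 0 := by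
    have hc := IsDInt.const (Nat.lcmUpto n) N (((-1) ^ ((r' + 1) * n)) ^ (b + 1 + 1) * (-1) ^ (n * (b + 1))) 0
    have hs := IsDInt.sum (range (n + 1))
      (F := fun k ε => ∑ u ∈ range (n - k + 1), brickTermOdd n (r' + 1) M (b + 1) k u ε)
      (d := Nat.lcmUpto n) (N := N) (x := 0) fun k hk =>
        IsDInt.sum (range (n - k + 1)) (F := fun u ε => brickTermOdd n (r' + 1) M (b + 1) k u ε) (d := Nat.lcmUpto n)
          (N := N) (x := 0) fun u hu =>
            brickTermOdd_isDInt (Nat.succ_pos r') M (b + 1) (by have := mem_range.mp hk; have := mem_range.mp hu; omega) N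
    exact (hc.mul hs).congr (Eventually.of_forall fun ε => by push_cast; ring)
  refine hS.congr ?_
  have h1 : ∀ᶠ ε in nhds (0 : ℚ), ε < 1 / 2 := eventually_lt_nhds (by norm_num)
  have h2 : ∀ᶠ ε in nhds (0 : ℚ), -(1 / 2) < ε := eventually_gt_nhds (by norm_num)
  filter_upwards [h1, h2] with ε hε1 hε2
  have hn := prod_one_add_ne_zero' hε1 hε2 n
  have hrn := prod_one_add_ne_zero' hε1 hε2 ((r' + 1) * n)
  exact (gKROdd_eq_sum_brickTermOdd n M b r' hn.1 hn.2 hrn.1 hrn.2).symm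

/-! ### Assembly for `r ≥ 1`, `B = 1` -/

/-- `∏_{q<r} R(n,0;qn+1+ε) · n!^r = (1+ε)_{rn}` (local copy). [cite: KrattenthalerRivoal2007, §12 (eq:briques)] -/
private theorem pbBlockPlus_one_mul' (n r : ℕ) (ε : ℚ) :
    pbBlockPlus n r 1 ε * (n ! : ℚ) ^ r = ∏ l ∈ range (r * n), (1 + ε + (l : ℚ)) := by
  unfold pbBlockPlus polyBrick
  rw [prod_div_distrib, prod_const, card_range, div_mul_cancel₀ _ (by positivity), ← pw_def, pw_mul_blocks]
  refine prod_congr rfl fun q _ => ?_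
  rw [← pw_def]
  exact pw_congr (by push_cast; ring) _

/-- The `(k,u)` summand for odd `A`, `B = 1`: `(−1)^{k+v} · (R(0,n+1;−ε)(−ε))² · innerOFlat(k) · R₂ · R₁ · R(v,0;rn+i+2+ε)`.
[cite: KrattenthalerRivoal2007, §12 proof of Proposition 6 («Le cas B = 1 … Corollaires 5 et 6»), odd A] -/
def brickTermOddOne (n r M k u : ℕ) (ε : ℚ) : ℚ :=
  (-1) ^ (k + (n - k - u)) * rbMinus n ε ^ 2 * innerOFlat n r M 0 k ε *
    (specialBrickR2 n r k (k + u) ε * specialBrickR1 n r (k + u) (k + u) ε *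
      polyBrick (((r * n + (k + u) + 2 : ℕ) : ℤ)) (n - k - u) ε)

/-- Every `brickTermOddOne` is `d_n`-integral to all orders at `ε = 0`. [cite: KrattenthalerRivoal2007, §11 Lemmes 9–10] -/
theorem brickTermOddOne_isDInt {n r : ℕ} (hr : 1 ≤ r) (M : ℕ) {k u : ℕ} (hku : k + u ≤ n) (N : ℕ) :
    IsDInt (Nat.lcmUpto n) N (brickTermOddOne n r M k u) 0 := by
  have h1 := IsDInt.const (Nat.lcmUpto n) N ((-1) ^ (k + (n - k - u))) 0
  have h2 := (rbMinus_isDInt (n := n) (i := n) le_rfl N).pow 2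
  have h3 := innerOFlat_isDInt (n := n) (r := r) N M 0 k (by omega)
  have h4 := specialBrickR2_isDInt n r k (k + u) hr (by omega) hku N
  have h6 := specialBrickR1_isDInt n r (k + u) (k + u) hr hku N
  have h7 := polyBrick_eps_isDInt (((r * n + (k + u) + 2 : ℕ) : ℤ)) (show n - k - u ≤ n by omega) N
  exact (((h1.mul h2).mul h3).mul ((h4.mul h6).mul h7)).congr
    (Eventually.of_forall fun ε => by simp only [brickTermOddOne]; push_cast; ring)

/-- The normalisers for odd `A`, `B = 1` collapse to `(n!/(1−ε)_n)²`. [cite: KrattenthalerRivoal2007, §12 proof of Proposition 6, odd A] -/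
private theorem assembly_scalar_odd_one (n r M : ℕ) {Rm Rp Dm Dp : ℚ} (hRm : Rm ≠ 0) (hRp : Rp ≠ 0) (hDm : Dm ≠ 0)
    (hDp : Dp ≠ 0) :
    (n ! : ℚ) ^ (2 * M + 2) * (Rm * Rp) ^ (0 + 1) /
        ((Dm * Dp) ^ (2 * M + 3 + (0 + 1)) * (n ! : ℚ) ^ (2 * (0 + 1) * r)) *
      (Dp ^ 2 * ((Dm * Dp) ^ 2) ^ M * (Dm * Dp) / (((n ! : ℚ) ^ 2) ^ M * (n ! : ℚ))) *
      ((n ! : ℚ) ^ (3 * r) * (n ! : ℚ) * Dm * Dp / (Rm * Rp ^ 2)) * (Rp / (n ! : ℚ) ^ r) =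
      ((n ! : ℚ) / Dm) ^ 2 := by
  have hn : (n ! : ℚ) ≠ 0 := by positivity
  rw [div_mul_div_comm, div_mul_div_comm, div_mul_div_comm, div_pow, div_eq_div_iff (by positivity) (pow_ne_zero _ hDm)]
  ring

/-- The pointwise identity for odd `A`, `B = 1`, `r ≥ 1`: near `ε = 0`, `gKROdd n M 0 r = (−1)^{rn} · Σ_k Σ_u brickTermOddOne(k,u)`.
[cite: KrattenthalerRivoal2007, §12 proof of Proposition 6; §10 Corollaire 6] -/
theorem gKROdd_zero_eq_sum_brickTermOddOne (n M r : ℕ) (hr : 1 ≤ r) {ε : ℚ}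
    (hDm : ∏ l ∈ range n, (1 - ε + (l : ℚ)) ≠ 0) (hDp : ∏ l ∈ range n, (1 + ε + (l : ℚ)) ≠ 0)
    (hRm : ∏ l ∈ range (r * n), (1 - ε + (l : ℚ)) ≠ 0) (hRp : ∏ l ∈ range (r * n), (1 + ε + (l : ℚ)) ≠ 0) :
    gKROdd n M 0 r ε = ((-1 : ℚ) ^ (r * n)) ^ (0 + 1) * (-1) ^ (n * 0) *
      ∑ k ∈ range (n + 1), ∑ u ∈ range (n - k + 1), brickTermOddOne n r M k u ε := by
  unfold gKROdd
  rw [sPolFour_eq_KR, mul_sum, mul_sum]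
  refine sum_congr rfl fun k hk => ?_
  have hkn : k ≤ n := Nat.lt_succ_iff.mp (mem_range.mp hk)
  set Rm := ∏ l ∈ range (r * n), (1 - ε + (l : ℚ)) with hRmdef
  set Rp := ∏ l ∈ range (r * n), (1 + ε + (l : ℚ)) with hRpdef
  set Dm := ∏ l ∈ range n, (1 - ε + (l : ℚ)) with hDmdef
  set Dp := ∏ l ∈ range n, (1 + ε + (l : ℚ)) with hDpdef
  have hn : (n ! : ℚ) ≠ 0 := by positivity
  have hT : ((n ! : ℚ) ^ 2) ^ M * (n ! : ℚ) ≠ 0 := by positivity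
  have e1 : rawInnerO n r M 0 k ε = Dp ^ 2 * ((Dm * Dp) ^ 2) ^ M * (Dm * Dp) *
      ((k ! : ℚ) * innerOFlat n r M 0 k ε) / (((n ! : ℚ) ^ 2) ^ M * (n ! : ℚ)) := by
    rw [eq_div_iff hT, ← innerO_eq_flat]
    have h := rawInnerO_dictionary n r M 0 k hkn hDp hDm
    simp only [normEXO, normDXO] at h
    rw [← hDmdef, ← hDpdef] at h
    linear_combination h
  have e3 : ∀ u ∈ range (n - k + 1), topRaw n r k u ε =
      (-1) ^ (k + (n - k - u)) * ((n ! : ℚ) ^ (3 * r) * (n ! : ℚ) * Dm * Dp) *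
        (specialBrickR2 n r k (k + u) ε * pbBlockPlus n r 1 ε * specialBrickR1 n r (k + u) (k + u) ε *
          polyBrick (((r * n + (k + u) + 2 : ℕ) : ℤ)) (n - k - u) ε) / (Rm * Rp ^ 2) := fun u hu => by
    rw [eq_div_iff (mul_ne_zero hRm (pow_ne_zero _ hRp))]
    linear_combination top_brick_identity n r k u hr (by have := mem_range.mp hu; omega) ε
  have hpbB : pbBlockPlus n r 1 ε = Rp / (n ! : ℚ) ^ r := by
    rw [eq_div_iff (by positivity), hRpdef]; exact pbBlockPlus_one_mul' n r ε
  have hsc := assembly_scalar_odd_one n r M hRm hRp hDm hDp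
  calc ((-1 : ℚ) ^ (r * n)) ^ (0 + 1) * (-1) ^ (n * 0) *
        ((n ! : ℚ) ^ (2 * M + 2) * (Rm * Rp) ^ (0 + 1) /
          ((Dm * Dp) ^ (2 * M + 3 + (0 + 1)) * (n ! : ℚ) ^ (2 * (0 + 1) * r))) *
        ((n.choose k : ℚ) * (∏ j ∈ range k, (ε - n + j)) * (∏ j ∈ range k, (((r * n : ℕ) : ℚ) + ε + 1 + j)) *
          rawInnerO n r M 0 k ε * balFourFThreeKR ε n r k)
      = ((-1 : ℚ) ^ (r * n)) ^ (0 + 1) * (-1) ^ (n * 0) *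
        ((n ! : ℚ) ^ (2 * M + 2) * (Rm * Rp) ^ (0 + 1) /
          ((Dm * Dp) ^ (2 * M + 3 + (0 + 1)) * (n ! : ℚ) ^ (2 * (0 + 1) * r))) *
        (Dp ^ 2 * ((Dm * Dp) ^ 2) ^ M * (Dm * Dp) / (((n ! : ℚ) ^ 2) ^ M * (n ! : ℚ))) * innerOFlat n r M 0 k ε *
        ∑ u ∈ range (n - k + 1), topRaw n r k u ε := by
        rw [e1, topRaw_sum]; ring
    _ = ∑ u ∈ range (n - k + 1), ((-1 : ℚ) ^ (r * n)) ^ (0 + 1) * (-1) ^ (n * 0) *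
        ((n ! : ℚ) ^ (2 * M + 2) * (Rm * Rp) ^ (0 + 1) /
          ((Dm * Dp) ^ (2 * M + 3 + (0 + 1)) * (n ! : ℚ) ^ (2 * (0 + 1) * r))) *
        (Dp ^ 2 * ((Dm * Dp) ^ 2) ^ M * (Dm * Dp) / (((n ! : ℚ) ^ 2) ^ M * (n ! : ℚ))) * innerOFlat n r M 0 k ε *
        topRaw n r k u ε := by rw [mul_sum]
    _ = ∑ u ∈ range (n - k + 1), ((-1 : ℚ) ^ (r * n)) ^ (0 + 1) * (-1) ^ (n * 0) *
        brickTermOddOne n r M k u ε := by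
        refine sum_congr rfl fun u hu => ?_
        rw [e3 u hu, brickTermOddOne, rbMinus, ← hDmdef, hpbB]
        calc _ = ((-1 : ℚ) ^ (r * n)) ^ (0 + 1) * (-1) ^ (n * 0) * ((-1) ^ (k + (n - k - u)) *
              innerOFlat n r M 0 k ε *
              (specialBrickR2 n r k (k + u) ε * specialBrickR1 n r (k + u) (k + u) ε *
                polyBrick (((r * n + (k + u) + 2 : ℕ) : ℤ)) (n - k - u) ε)) *
            ((n ! : ℚ) ^ (2 * M + 2) * (Rm * Rp) ^ (0 + 1) /
                ((Dm * Dp) ^ (2 * M + 3 + (0 + 1)) * (n ! : ℚ) ^ (2 * (0 + 1) * r)) *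
              (Dp ^ 2 * ((Dm * Dp) ^ 2) ^ M * (Dm * Dp) / (((n ! : ℚ) ^ 2) ^ M * (n ! : ℚ))) *
              ((n ! : ℚ) ^ (3 * r) * (n ! : ℚ) * Dm * Dp / (Rm * Rp ^ 2)) * (Rp / (n ! : ℚ) ^ r)) := by ring
          _ = _ := by rw [hsc]; ring
    _ = _ := by rw [← mul_sum]

/-- **Proposition 6, case `A = 2M+3` odd, `B = 1`, `r ≥ 1`**: for every `N`, `IsDInt (d_n) N (gKROdd n M 0 r) 0`.
[cite: KrattenthalerRivoal2007, §12 Proposition 6 (i), case A odd, B = 1] -/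
theorem proposition6_oddA_one (n M r : ℕ) (hr : 1 ≤ r) (N : ℕ) : IsDInt (Nat.lcmUpto n) N (gKROdd n M 0 r) 0 := by
  have hS : IsDInt (Nat.lcmUpto n) N (fun ε => ((-1 : ℚ) ^ (r * n)) ^ (0 + 1) * (-1) ^ (n * 0) *
      ∑ k ∈ range (n + 1), ∑ u ∈ range (n - k + 1), brickTermOddOne n r M k u ε) 0 := by
    have hc := IsDInt.const (Nat.lcmUpto n) N (((-1) ^ (r * n)) ^ (0 + 1) * (-1) ^ (n * 0)) 0
    have hs := IsDInt.sum (range (n + 1)) (F := fun k ε => ∑ u ∈ range (n - k + 1), brickTermOddOne n r M k u ε)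
      (d := Nat.lcmUpto n) (N := N) (x := 0) fun k hk =>
        IsDInt.sum (range (n - k + 1)) (F := fun u ε => brickTermOddOne n r M k u ε) (d := Nat.lcmUpto n)
          (N := N) (x := 0) fun u hu =>
            brickTermOddOne_isDInt hr M (by have := mem_range.mp hk; have := mem_range.mp hu; omega) N
    exact (hc.mul hs).congr (Eventually.of_forall fun ε => by push_cast; ring)
  refine hS.congr ?_
  have h1 : ∀ᶠ ε in nhds (0 : ℚ), ε < 1 / 2 := eventually_lt_nhds (by norm_num)
  have h2 : ∀ᶠ ε in nhds (0 : ℚ), -(1 / 2) < ε := eventually_gt_nhds (by norm_num)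
  filter_upwards [h1, h2] with ε hε1 hε2
  have hn := prod_one_add_ne_zero' hε1 hε2 n
  have hrn := prod_one_add_ne_zero' hε1 hε2 (r * n)
  exact (gKROdd_zero_eq_sum_brickTermOddOne n M r hr hn.1 hn.2 hrn.1 hrn.2).symm

/-! ### The case `r = 0` (degenerate top line) -/

/-- **(eq:briques) for odd `A`, `B ≥ 2`, `r = 0`**: off the zeros of `(1∓ε)_n`,
`gKROdd n M (b+1) 0 = (−1)^{n(b+1)} Σ_{k≤n} (−1)^k C(n+1,k+1) · (R(0,n+1;−ε)(−ε))² · innerOFlat(k)`.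
[cite: KrattenthalerRivoal2007, §12 proof of Proposition 6, (eq:briques), odd A, r = 0] -/
theorem gKROdd_zero_r_eq_sum (n M b : ℕ) {ε : ℚ}
    (hDm : ∏ l ∈ range n, (1 - ε + (l : ℚ)) ≠ 0) (hDp : ∏ l ∈ range n, (1 + ε + (l : ℚ)) ≠ 0) :
    gKROdd n M (b + 1) 0 ε = (-1) ^ (n * (b + 1)) *
      ∑ k ∈ range (n + 1), (-1) ^ k * ((n + 1).choose (k + 1) : ℚ) * (rbMinus n ε ^ 2 * innerOFlat n 0 M (b + 1) k ε) := by
  unfold gKROdd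
  rw [sPolFour_eq_KR, mul_sum, mul_sum]
  refine sum_congr rfl fun k hk => ?_
  have hkn : k ≤ n := Nat.lt_succ_iff.mp (mem_range.mp hk)
  set Dm := ∏ l ∈ range n, (1 - ε + (l : ℚ)) with hDmdef
  set Dp := ∏ l ∈ range n, (1 + ε + (l : ℚ)) with hDpdef
  have hn : (n ! : ℚ) ≠ 0 := by positivity
  have hEX : ((n ! : ℚ) ^ 2) ^ M * (n ! : ℚ) ≠ 0 := by positivity
  have hEXv : normEXO n 0 ε (b + 1) = (n ! : ℚ) := by simp [normEXO]
  have hDXv : normDXO n 0 ε (b + 1) = (Dm * Dp) ^ 2 * (Dm * Dp) ^ b := by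
    simp only [normDXO, Nat.mul_zero, pow_zero, one_mul, ← hDmdef, ← hDpdef]
  -- the inner dictionary, solved for `rawInnerO`
  have e1 : rawInnerO n 0 M (b + 1) k ε = Dp ^ 2 * ((Dm * Dp) ^ 2) ^ M * ((Dm * Dp) ^ 2 * (Dm * Dp) ^ b) *
      ((k ! : ℚ) * innerOFlat n 0 M (b + 1) k ε) / (((n ! : ℚ) ^ 2) ^ M * (n ! : ℚ)) := by
    rw [eq_div_iff hEX, ← innerO_eq_flat, ← hDXv]
    have h := rawInnerO_dictionary n 0 M (b + 1) k hkn hDp hDm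
    rw [hEXv] at h
    linear_combination h
  -- the top line: only `u = n−k` survives
  have e3 : ∑ u ∈ range (n - k + 1), topRaw n 0 k u ε =
      (-1) ^ k * ((n ! : ℚ) * ((n + 1).choose (k + 1) : ℚ)) * (Dm * Dp) := by
    rw [sum_range_succ, sum_eq_zero fun u hu => topRaw_zero_r_of_lt n k u (mem_range.mp hu) ε, zero_add,
      topRaw_zero_r_top n k hkn ε]
  have e3' := topRaw_sum n 0 k ε
  rw [e3] at e3'
  have hk0 : (k ! : ℚ) ≠ 0 := by positivity
  calc ((-1 : ℚ) ^ (0 * n)) ^ (b + 1 + 1) * (-1) ^ (n * (b + 1)) *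
        ((n ! : ℚ) ^ (2 * M + 2) *
          ((∏ l ∈ range (0 * n), (1 - ε + (l : ℚ))) * ∏ l ∈ range (0 * n), (1 + ε + (l : ℚ))) ^ (b + 1 + 1) /
          ((Dm * Dp) ^ (2 * M + 3 + (b + 1 + 1)) * (n ! : ℚ) ^ (2 * (b + 1 + 1) * 0))) *
        ((n.choose k : ℚ) * (∏ j ∈ range k, (ε - n + j)) * (∏ j ∈ range k, (((0 * n : ℕ) : ℚ) + ε + 1 + j)) *
          rawInnerO n 0 M (b + 1) k ε * balFourFThreeKR ε n 0 k)
      = (-1) ^ (n * (b + 1)) * ((n ! : ℚ) ^ (2 * M + 2) / (Dm * Dp) ^ (2 * M + 3 + (b + 1 + 1))) *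
        (rawInnerO n 0 M (b + 1) k ε / (k ! : ℚ)) *
        ((n.choose k : ℚ) * (∏ j ∈ range k, (ε - n + j)) * (∏ j ∈ range k, (((0 * n : ℕ) : ℚ) + ε + 1 + j)) *
          (k ! : ℚ) * balFourFThreeKR ε n 0 k) := by
        simp only [Nat.zero_mul, Nat.mul_zero, range_zero, prod_empty, pow_zero, one_pow, mul_one, one_mul]
        field_simp
    _ = (-1) ^ (n * (b + 1)) * ((n ! : ℚ) ^ (2 * M + 2) / (Dm * Dp) ^ (2 * M + 3 + (b + 1 + 1))) *
        (Dp ^ 2 * ((Dm * Dp) ^ 2) ^ M * ((Dm * Dp) ^ 2 * (Dm * Dp) ^ b) *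
          innerOFlat n 0 M (b + 1) k ε / (((n ! : ℚ) ^ 2) ^ M * (n ! : ℚ))) *
        ((-1) ^ k * ((n ! : ℚ) * ((n + 1).choose (k + 1) : ℚ)) * (Dm * Dp)) := by
        rw [e3', e1]
        field_simp
    _ = (-1) ^ (n * (b + 1)) * ((-1) ^ k * ((n + 1).choose (k + 1) : ℚ) *
        (rbMinus n ε ^ 2 * innerOFlat n 0 M (b + 1) k ε)) := by
        rw [rbMinus, ← hDmdef]
        field_simp
        ring

/-- **(eq:briques) for odd `A`, `B = 1`, `r = 0`**: off the zeros of `(1∓ε)_n`,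
`gKROdd n M 0 0 = Σ_{k≤n} (−1)^k C(n+1,k+1) · (R(0,n+1;−ε)(−ε))² · innerOFlat(k)`.
[cite: KrattenthalerRivoal2007, §12 proof of Proposition 6, (eq:briques), odd A, B = 1, r = 0] -/
theorem gKROdd_zero_r_one_eq_sum (n M : ℕ) {ε : ℚ}
    (hDm : ∏ l ∈ range n, (1 - ε + (l : ℚ)) ≠ 0) (hDp : ∏ l ∈ range n, (1 + ε + (l : ℚ)) ≠ 0) :
    gKROdd n M 0 0 ε =
      ∑ k ∈ range (n + 1), (-1) ^ k * ((n + 1).choose (k + 1) : ℚ) * (rbMinus n ε ^ 2 * innerOFlat n 0 M 0 k ε) := by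
  unfold gKROdd
  rw [sPolFour_eq_KR, mul_sum]
  refine sum_congr rfl fun k hk => ?_
  have hkn : k ≤ n := Nat.lt_succ_iff.mp (mem_range.mp hk)
  set Dm := ∏ l ∈ range n, (1 - ε + (l : ℚ)) with hDmdef
  set Dp := ∏ l ∈ range n, (1 + ε + (l : ℚ)) with hDpdef
  have hn : (n ! : ℚ) ≠ 0 := by positivity
  have hEX : ((n ! : ℚ) ^ 2) ^ M * (n ! : ℚ) ≠ 0 := by positivity
  -- the inner dictionary, solved for `rawInnerO`
  have e1 : rawInnerO n 0 M 0 k ε = Dp ^ 2 * ((Dm * Dp) ^ 2) ^ M * (Dm * Dp) *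
      ((k ! : ℚ) * innerOFlat n 0 M 0 k ε) / (((n ! : ℚ) ^ 2) ^ M * (n ! : ℚ)) := by
    rw [eq_div_iff hEX, ← innerO_eq_flat]
    have h := rawInnerO_dictionary n 0 M 0 k hkn hDp hDm
    simp only [normEXO, normDXO] at h
    rw [← hDmdef, ← hDpdef] at h
    linear_combination h
  -- the top line: only `u = n−k` survives
  have e3 : ∑ u ∈ range (n - k + 1), topRaw n 0 k u ε =
      (-1) ^ k * ((n ! : ℚ) * ((n + 1).choose (k + 1) : ℚ)) * (Dm * Dp) := by
    rw [sum_range_succ, sum_eq_zero fun u hu => topRaw_zero_r_of_lt n k u (mem_range.mp hu) ε, zero_add,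
      topRaw_zero_r_top n k hkn ε]
  have e3' := topRaw_sum n 0 k ε
  rw [e3] at e3'
  have hk0 : (k ! : ℚ) ≠ 0 := by positivity
  calc ((-1 : ℚ) ^ (0 * n)) ^ (0 + 1) * (-1) ^ (n * 0) *
        ((n ! : ℚ) ^ (2 * M + 2) *
          ((∏ l ∈ range (0 * n), (1 - ε + (l : ℚ))) * ∏ l ∈ range (0 * n), (1 + ε + (l : ℚ))) ^ (0 + 1) /
          ((Dm * Dp) ^ (2 * M + 3 + (0 + 1)) * (n ! : ℚ) ^ (2 * (0 + 1) * 0))) *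
        ((n.choose k : ℚ) * (∏ j ∈ range k, (ε - n + j)) * (∏ j ∈ range k, (((0 * n : ℕ) : ℚ) + ε + 1 + j)) *
          rawInnerO n 0 M 0 k ε * balFourFThreeKR ε n 0 k)
      = ((n ! : ℚ) ^ (2 * M + 2) / (Dm * Dp) ^ (2 * M + 3 + (0 + 1))) *
        (rawInnerO n 0 M 0 k ε / (k ! : ℚ)) *
        ((n.choose k : ℚ) * (∏ j ∈ range k, (ε - n + j)) * (∏ j ∈ range k, (((0 * n : ℕ) : ℚ) + ε + 1 + j)) *
          (k ! : ℚ) * balFourFThreeKR ε n 0 k) := by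
        simp only [Nat.zero_mul, Nat.mul_zero, range_zero, prod_empty, pow_zero, one_pow, mul_one, one_mul]
        field_simp
    _ = ((n ! : ℚ) ^ (2 * M + 2) / (Dm * Dp) ^ (2 * M + 3 + (0 + 1))) *
        (Dp ^ 2 * ((Dm * Dp) ^ 2) ^ M * (Dm * Dp) * innerOFlat n 0 M 0 k ε / (((n ! : ℚ) ^ 2) ^ M * (n ! : ℚ))) *
        ((-1) ^ k * ((n ! : ℚ) * ((n + 1).choose (k + 1) : ℚ)) * (Dm * Dp)) := by
        rw [e3', e1]
        field_simp
    _ = (-1) ^ k * ((n + 1).choose (k + 1) : ℚ) * (rbMinus n ε ^ 2 * innerOFlat n 0 M 0 k ε) := by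
        rw [rbMinus, ← hDmdef]
        field_simp
        ring

/-- **Proposition 6, case `A = 2M+3` odd, any `B ≥ 1`, `r = 0`**: for every `N`, `IsDInt (d_n) N (gKROdd n M B' 0) 0`.
[cite: KrattenthalerRivoal2007, §12 Proposition 6 (i), case A odd, r = 0] -/
theorem proposition6_odd_zero_r (n M B' : ℕ) (N : ℕ) : IsDInt (Nat.lcmUpto n) N (gKROdd n M B' 0) 0 := by
  have h1 : ∀ᶠ ε in nhds (0 : ℚ), ε < 1 / 2 := eventually_lt_nhds (by norm_num)
  have h2 : ∀ᶠ ε in nhds (0 : ℚ), -(1 / 2) < ε := eventually_gt_nhds (by norm_num)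
  have hc : ∀ k : ℕ, IsDInt (Nat.lcmUpto n) N (fun _ : ℚ => (-1 : ℚ) ^ k * ((n + 1).choose (k + 1) : ℚ)) 0 := fun k =>
    (IsDInt.const (Nat.lcmUpto n) N ((-1) ^ k * ((n + 1).choose (k + 1) : ℤ)) 0).congr
      (Eventually.of_forall fun _ => by push_cast; ring)
  have hs : IsDInt (Nat.lcmUpto n) N (fun ε => ∑ k ∈ range (n + 1),
      (-1) ^ k * ((n + 1).choose (k + 1) : ℚ) * (rbMinus n ε ^ 2 * innerOFlat n 0 M B' k ε)) 0 :=
    IsDInt.sum (range (n + 1)) (d := Nat.lcmUpto n) (N := N) (x := 0)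
      (F := fun k ε => (-1) ^ k * ((n + 1).choose (k + 1) : ℚ) * (rbMinus n ε ^ 2 * innerOFlat n 0 M B' k ε))
      fun k hk => (hc k).mul (((rbMinus_isDInt (n := n) (i := n) le_rfl N).pow 2).mul
        (innerOFlat_isDInt (n := n) (r := 0) N M B' k (Nat.lt_succ_iff.mp (mem_range.mp hk))))
  cases B' with
  | zero =>
    refine hs.congr ?_
    filter_upwards [h1, h2] with ε hε1 hε2
    have hne := prod_one_add_ne_zero' hε1 hε2 n
    exact (gKROdd_zero_r_one_eq_sum n M hne.1 hne.2).symm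
  | succ b =>
    have hS : IsDInt (Nat.lcmUpto n) N (fun ε => (-1 : ℚ) ^ (n * (b + 1)) * ∑ k ∈ range (n + 1),
        (-1) ^ k * ((n + 1).choose (k + 1) : ℚ) * (rbMinus n ε ^ 2 * innerOFlat n 0 M (b + 1) k ε)) 0 := by
      have hsgn := IsDInt.const (Nat.lcmUpto n) N ((-1) ^ (n * (b + 1))) 0
      exact (hsgn.mul hs).congr (Eventually.of_forall fun ε => by push_cast; ring)
    refine hS.congr ?_
    filter_upwards [h1, h2] with ε hε1 hε2
    have hne := prod_one_add_ne_zero' hε1 hε2 n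
    exact (gKROdd_zero_r_eq_sum n M b hne.1 hne.2).symm

/-- **Proposition 6 for every odd `A ≥ 3`, every `B ≥ 1` and every `r ≥ 0`**: for every `N`,
`IsDInt (d_n) N (gKROdd n M B' r) 0` — i.e. `d_n^{h−1} K 𝒟_h S_{2M+3,B'+1,r}(n)(0) ∈ ℤ` for all `h ≥ 1`
(`𝒟_h(ε·g)(0) = 𝒟_{h−1} g(0)`). With `proposition6_even'` this is Krattenthaler–Rivoal's Proposition 6 in full.
[cite: KrattenthalerRivoal2007, §12 Proposition 6 (i) (arXiv:math/0311114 p. 29), case A odd] -/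
theorem proposition6_odd' (n M B' r : ℕ) (N : ℕ) : IsDInt (Nat.lcmUpto n) N (gKROdd n M B' r) 0 := by
  rcases Nat.eq_zero_or_pos r with rfl | hr
  · exact proposition6_odd_zero_r n M B' N
  · obtain ⟨r', rfl⟩ : ∃ r', r = r' + 1 := ⟨r - 1, by omega⟩
    cases B' with
    | zero => exact proposition6_oddA_one n M (r' + 1) hr N
    | succ b => exact proposition6_oddA n M b r' N

end Literature.NumberTheory.Irrationality.KrattenthalerRivoal2007
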